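import Summits.QuantumFields.BalabanUV.Beta.GAN24.Entry110Rect
import Summits.QuantumFields.BalabanUV.Beta.GAN24.Entry112SupLogCubicFlat
import Summits.QuantumFields.BalabanUV.Beta.GAN24.BlockFieldDecay
import Literature.MathematicalPhysics.QuantumFieldTheory.Balaban1983to89.B5G110BlockRowSum

/-!
# G-an2-4 ∕ (CONV-C), road P2 — THE VECTOR LETTERS OF [B5] (1.110)∕(1.112) AT `U = 1`, `a = 1` IN THE ROW's `RowDecay` CURRENCY (per-block row
# decay on the vector carrier `Tor (fine n M) × Fin (d+1)`, block map `blockOf ∘ Prod.fst`): the zeroth and first-order letters on EVERY torus,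
# the second-order letters with `(1 + log n)` on every CUBIC torus — an EXPORT of landed tree theorems, nothing new estimated

G-an2-4 formalisation swarm `b2b-balaban-gan24-formalise-*`, leaf prover 06 (gen 36), crux team (2) under the coordinator ruling «YM REDIRECT»
(e34b3e0c; FREEZE (0) honoured — a `GAN24/` export importing EXISTING modules only).  The road-P2 chair `b2b-balaban-gan24-p2` (gen 30) landed
the VECTOR unit-lattice constituent `c_n = Q_n𝒢_nQ_n*` with its one-step SUP law (journal 2026-08-21T11:03Z) and listed as NOT DONE «the
kernel∕decay currency (needs the LOCALIZED vector rows — `Entry110*Cubic` ∕ `entry112*` bodies in `RowDecay` form)».  THIS FILE is the vector twin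
of this lineage's `ScalarSupLettersCubicHolds.scalarRowDecay_cubic` (gen 35): the five operators behind the six letters of `AveragedPropagatorOneStepSup`'s
sup END (`𝒢` at both levels, `𝒢∇ᴴ_ν`, `∇_ν𝒢`, `𝒢∇ᴴ_μ∇ᴴ_ν`, `∇_μ∇_ν𝒢`; `𝒢 = (DeltaA n M 1)⁻¹`, `∇_ν = fdiff (fine n M) n ν`) — plus `Δ𝒢`, as
`BlockFieldDecay.RowDecay M (fun i ⇒ blockOf n M i.1) (fun x′ ⇒ blockOf n M x′.1) K C δ` bodies, constants FUNCTIONS OF `d` ONLY, uniform in `n` and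
in the torus; every input BY NAME:
 * §1 `rowDecay_inv_one` — `𝒢` itself, EVERY torus: lit-balaban's `B5G110BlockRowSum.block_row_sum_le` (pv15's (1.110) first entry in row-sum
   currency), re-indexed to an arbitrary row through `bpt_bijective`, the two rates merged (`min`) and the two constants summed;
 * §2 `rowDecay_fdiff_inv_one` (`∇_ν𝒢`), `rowDecay_inv_fdiffH_one` (`𝒢∇ᴴ_ν`), `rowDecay_Lap_inv_one` (`Δ𝒢`), EVERY torus: leaf-02 gen 42's
   `Entry110Rect.block_row_sum_*` (leaf-04's cubic rows descended along the covering) — their statements ARE the `RowDecay` bodies;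
 * §3 `rowDecay_fdiff_fdiff_inv_one_cubic` (`∇_μ∇_ν𝒢`, bound `C·(1 + log n)`), `rowDecay_inv_fdiffH_fdiffH_one_cubic` (`𝒢∇ᴴ_μ∇ᴴ_ν`), CUBIC tori:
   leaf-04 gen 47's `SndDiffRowSumTransport.block_row_sum_*_cubic_of_flat` on leaf-03 gen 48's flat second-order rows
   (`SliceFlatHessian.cubeSum_rowDiff_rowDiff_gFlat_le`, `Entry112SupLogCubicFlat.hcol_swapped`);
 * §4 **`vectorRowDecay_one_cubic`** — the five letters of the decay currency in ONE statement with ONE pair `(C, δ)` (max ∕ min packaging by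
   `RowDecay.mono`) on every cubic unit torus `fun _ : Fin (d+1) ⇒ N₀`, every `n ≥ 1`.
HONEST SCOPE.  [folklore] repackaging of tree theorems BY NAME (`obtain` + `RowDecay.mono`); VECTOR `Δ_1⁻¹` at `U = 1`, `a = 1` ONLY (general
`a ≠ 1` letters are not in the tree in row-sum form); second order on CUBIC tori only (the NE3 flat carrier has one period); constants ∕ rates
existential (functions of `d`); the `(1 + log n)` is OURS and genuine (idea-1 (P-R7k)); [B5] Prop. 1.2 (1.110)∕(1.112) (`Balaban1984PropagatorsI`
pp. 35–36) are TEXT LOCATIONS — nothing printed is asserted, no `[cite:]` claim; NOT (CONV-C) as typed, NEVER «G-an2-4 closed», NOT NE2 ∕ NE3, NOT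
D1, NOT BetaPertH, NOT continuum, NOT Clay; 0 def, 0 `def … : Prop`, 0 sorry — not in print, our bookkeeping.  HONEST DEPENDENCY: continuum YM on
T⁴ ⇐ BetaPertH ∧ nine spine estimates (0/9 proved); BetaPertH ⇐ (D1) ∧ (D4) ∧ CAP+tail; G-an2-4 gates asym, D1 and NE2/3/4.
-/

noncomputable section

open scoped BigOperators ComplexConjugate Matrix

namespace Summit.QuantumFields.BalabanUV.Beta.GAN24.VectorRowDecayLetters

open Literature.MathematicalPhysics.QuantumFieldTheory.Balaban1983to89
open B5Prop11Plancherel (Tor fine fdiff)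
open B5Prop11Lower (Lap)
open B5Block118 (bpt)
open B5Blocks16 (blockOf blockOf_bpt bpt_bijective)
open B5DeltaA169 (DeltaA)
open B5G183Strip (kappa183 kappa183_pos)
open B5G183CovDecay (MD183 MD183_nonneg)
open B4TorusKernel (periodConst)
open B5Kernel166Decay (periodConst_pos)
open B4TorusKernel.MultiPeriod (torusSupNorm torusSupNorm_nonneg)
open B6LowerBound2153Torus (rep)
open Summit.QuantumFields.BalabanUV.Beta.GAN24.BlockFieldDecay (RowDecay RowDecay.mono)

variable (d : ℕ)

/-! ## §1 The zeroth letter `𝒢 = Δ_1⁻¹`, every torus -/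

/-- **`𝒢 = Δ_1⁻¹` IN `RowDecay` FORM, EVERY TORUS, n-UNIFORM**: `∃ C δ > 0` (functions of `d`) with
`Σ_{x′ : blockOf x′.1 = y′} ‖𝒢(i, x′)‖ ≤ C·e^{−δ·|rep(blockOf i.1) − rep y′|_{T,∞}}` for every `n ≥ 1`, every torus, every row `i`, every block `y′`
— `B5G110BlockRowSum.block_row_sum_le` (splitting order `N = d`) with `δ = min(1∕(2(d+1)), κ₁₈₃(d+1)∕(d+1))`, `C = C₁ + (d+1)C₂`. [folklore] -/
theorem rowDecay_inv_one :
    ∃ C δ : ℝ, 0 < C ∧ 0 < δ ∧ ∀ (n : ℕ) (M : Fin (d + 1) → ℕ) [NeZero n] [∀ μ, NeZero (M μ)],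
      RowDecay M (fun i : Tor (fine n M) × Fin (d + 1) => blockOf n M i.1) (fun x' : Tor (fine n M) × Fin (d + 1) => blockOf n M x'.1)
        (DeltaA n M 1)⁻¹ C δ := by
  set δ₁ : ℝ := 1 / (2 * (d + 1)) with hδ₁
  set δ₂ : ℝ := kappa183 (d + 1) / (d + 1) with hδ₂
  set C₁ : ℝ := 2 * d * 2 ^ d * Real.exp (1 / (2 * (d + 1))) with hC₁
  set C₂ : ℝ := (d + 1) * (MD183 (d + 1) d * periodConst (kappa183 (d + 1)) d) with hC₂
  have hδ₁0 : 0 < δ₁ := by positivity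
  have hδ₂0 : 0 < δ₂ := div_pos (kappa183_pos _) (by positivity)
  have hC₁0 : 0 ≤ C₁ := by positivity
  have hC₂0 : 0 ≤ C₂ := by
    have h1 := MD183_nonneg (d + 1) d
    have h2 := (periodConst_pos (kappa183_pos (d + 1)) d).le
    positivity
  refine ⟨C₁ + C₂ + 1, min δ₁ δ₂, by positivity, lt_min hδ₁0 hδ₂0, ?_⟩
  intro n M _ _ i y'
  obtain ⟨x, μ⟩ := i
  obtain ⟨⟨b, r⟩, rfl⟩ := (bpt_bijective n M).2 x
  have hn : 1 ≤ n := Nat.one_le_iff_ne_zero.mpr (NeZero.ne n)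
  have h := B5G110BlockRowSum.block_row_sum_le n hn M (Nn := d) le_rfl b y' r μ
  dsimp only
  rw [blockOf_bpt]
  refine h.trans ?_
  set t := torusSupNorm M (rep M b - rep M y') with ht
  have ht0 : 0 ≤ t := torusSupNorm_nonneg (fun i => Nat.one_le_iff_ne_zero.mpr (NeZero.ne (M i))) _
  have e1 : Real.exp (-(1 / (2 * (d + 1)) * t)) ≤ Real.exp (-(min δ₁ δ₂ * t)) :=
    Real.exp_le_exp.mpr (by nlinarith [min_le_left δ₁ δ₂])
  have e2 : Real.exp (-(kappa183 (d + 1) / (d + 1) * t)) ≤ Real.exp (-(min δ₁ δ₂ * t)) :=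
    Real.exp_le_exp.mpr (by nlinarith [min_le_right δ₁ δ₂])
  have hE : 0 ≤ Real.exp (-(min δ₁ δ₂ * t)) := (Real.exp_pos _).le
  calc 2 * (d : ℝ) * 2 ^ d * Real.exp (1 / (2 * (d + 1))) * Real.exp (-(1 / (2 * (d + 1)) * t))
        + (d + 1) * (MD183 (d + 1) d * periodConst (kappa183 (d + 1)) d * Real.exp (-(kappa183 (d + 1) / (d + 1) * t)))
      = C₁ * Real.exp (-(1 / (2 * (d + 1)) * t)) + C₂ * Real.exp (-(kappa183 (d + 1) / (d + 1) * t)) := by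
        rw [hC₁, hC₂]; ring
    _ ≤ C₁ * Real.exp (-(min δ₁ δ₂ * t)) + C₂ * Real.exp (-(min δ₁ δ₂ * t)) :=
        add_le_add (mul_le_mul_of_nonneg_left e1 hC₁0) (mul_le_mul_of_nonneg_left e2 hC₂0)
    _ ≤ (C₁ + C₂ + 1) * Real.exp (-(min δ₁ δ₂ * t)) := by nlinarith

/-! ## §2 The first-order letters and `Δ𝒢`, every torus -/

/-- **`∇_ν𝒢` IN `RowDecay` FORM, EVERY TORUS, n-UNIFORM** (`Entry110Rect.block_row_sum_fdiff_inv_le` BY NAME — its statement is the body). [folklore] -/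
theorem rowDecay_fdiff_inv_one :
    ∃ C δ : ℝ, 0 < C ∧ 0 < δ ∧ ∀ (n : ℕ) (M : Fin (d + 1) → ℕ) [NeZero n] [∀ μ, NeZero (M μ)] (ν : Fin (d + 1)),
      RowDecay M (fun i : Tor (fine n M) × Fin (d + 1) => blockOf n M i.1) (fun x' : Tor (fine n M) × Fin (d + 1) => blockOf n M x'.1)
        (fdiff (fine n M) (n : ℂ) ν * (DeltaA n M 1)⁻¹) C δ := by
  obtain ⟨B, δ, hB, hδ, h⟩ := Entry110Rect.block_row_sum_fdiff_inv_le (d := d)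
  exact ⟨B, δ, hB, hδ, fun n M _ _ ν i y' => h n M ν i y'⟩

/-- **`𝒢∇ᴴ_ν` IN `RowDecay` FORM, EVERY TORUS, n-UNIFORM** (`Entry110Rect.block_row_sum_inv_fdiffH_le` BY NAME). [folklore] -/
theorem rowDecay_inv_fdiffH_one :
    ∃ C δ : ℝ, 0 < C ∧ 0 < δ ∧ ∀ (n : ℕ) (M : Fin (d + 1) → ℕ) [NeZero n] [∀ μ, NeZero (M μ)] (ν : Fin (d + 1)),
      RowDecay M (fun i : Tor (fine n M) × Fin (d + 1) => blockOf n M i.1) (fun x' : Tor (fine n M) × Fin (d + 1) => blockOf n M x'.1)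
        ((DeltaA n M 1)⁻¹ * (fdiff (fine n M) (n : ℂ) ν)ᴴ) C δ := by
  obtain ⟨B, δ, hB, hδ, h⟩ := Entry110Rect.block_row_sum_inv_fdiffH_le (d := d)
  exact ⟨B, δ, hB, hδ, fun n M _ _ ν i y' => h n M ν i y'⟩

/-- **`Δ𝒢` IN `RowDecay` FORM, EVERY TORUS, n-UNIFORM** (`Entry110Rect.block_row_sum_Lap_mul_inv_le` BY NAME; `Δ = B5Prop11Lower.Lap n M`). [folklore] -/
theorem rowDecay_Lap_inv_one :
    ∃ C δ : ℝ, 0 < C ∧ 0 < δ ∧ ∀ (n : ℕ) (M : Fin (d + 1) → ℕ) [NeZero n] [∀ μ, NeZero (M μ)],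
      RowDecay M (fun i : Tor (fine n M) × Fin (d + 1) => blockOf n M i.1) (fun x' : Tor (fine n M) × Fin (d + 1) => blockOf n M x'.1)
        (Lap n M * (DeltaA n M 1)⁻¹) C δ := by
  obtain ⟨B, δ, hB, hδ, h⟩ := Entry110Rect.block_row_sum_Lap_mul_inv_le (d := d)
  exact ⟨B, δ, hB, hδ, fun n M _ _ i y' => h n M i y'⟩

/-! ## §3 The second-order letters with `(1 + log n)`, cubic tori -/

/-- **`∇_μ∇_ν𝒢` IN `RowDecay` FORM WITH `C·(1 + log n)`, EVERY CUBIC UNIT TORUS, n-UNIFORM** (leaf-04's transport on leaf-03's flat second-order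
rows, BY NAME). [folklore] -/
theorem rowDecay_fdiff_fdiff_inv_one_cubic :
    ∃ C δ : ℝ, 0 < C ∧ 0 < δ ∧ ∀ (n N₀ : ℕ) [NeZero n] [NeZero N₀] (μ ν : Fin (d + 1)),
      RowDecay (fun _ : Fin (d + 1) => N₀)
        (fun i : Tor (fine n (fun _ : Fin (d + 1) => N₀)) × Fin (d + 1) => blockOf n (fun _ : Fin (d + 1) => N₀) i.1)
        (fun x' : Tor (fine n (fun _ : Fin (d + 1) => N₀)) × Fin (d + 1) => blockOf n (fun _ : Fin (d + 1) => N₀) x'.1)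
        (fdiff (fine n (fun _ : Fin (d + 1) => N₀)) (n : ℂ) μ * fdiff (fine n (fun _ : Fin (d + 1) => N₀)) (n : ℂ) ν
          * (DeltaA n (fun _ : Fin (d + 1) => N₀) 1)⁻¹) (C * (1 + Real.log n)) δ := by
  obtain ⟨B, δ, hB, hδ, h⟩ :=
    SndDiffRowSumTransport.block_row_sum_fdiff_fdiff_inv_le_cubic_of_flat (d := d) (SliceFlatHessian.cubeSum_rowDiff_rowDiff_gFlat_le d)
  exact ⟨B, δ, hB, hδ, fun n N₀ _ _ μ ν i y' => h n N₀ μ ν i y'⟩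

/-- **`𝒢∇ᴴ_μ∇ᴴ_ν` IN `RowDecay` FORM WITH `C·(1 + log n)`, EVERY CUBIC UNIT TORUS, n-UNIFORM** (leaf-04's transport on leaf-03's flat operator-form
rows, BY NAME). [folklore] -/
theorem rowDecay_inv_fdiffH_fdiffH_one_cubic :
    ∃ C δ : ℝ, 0 < C ∧ 0 < δ ∧ ∀ (n N₀ : ℕ) [NeZero n] [NeZero N₀] (μ ν : Fin (d + 1)),
      RowDecay (fun _ : Fin (d + 1) => N₀)
        (fun i : Tor (fine n (fun _ : Fin (d + 1) => N₀)) × Fin (d + 1) => blockOf n (fun _ : Fin (d + 1) => N₀) i.1)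
        (fun x' : Tor (fine n (fun _ : Fin (d + 1) => N₀)) × Fin (d + 1) => blockOf n (fun _ : Fin (d + 1) => N₀) x'.1)
        ((DeltaA n (fun _ : Fin (d + 1) => N₀) 1)⁻¹ * (fdiff (fine n (fun _ : Fin (d + 1) => N₀)) (n : ℂ) μ)ᴴ
          * (fdiff (fine n (fun _ : Fin (d + 1) => N₀)) (n : ℂ) ν)ᴴ) (C * (1 + Real.log n)) δ := by
  obtain ⟨B, δ, hB, hδ, h⟩ :=
    SndDiffRowSumTransport.block_row_sum_inv_fdiffH_fdiffH_le_cubic_of_flat (d := d) (Entry112SupLogCubicFlat.hcol_swapped d)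
  exact ⟨B, δ, hB, hδ, fun n N₀ _ _ μ ν i y' => h n N₀ μ ν i y'⟩

/-! ## §4 The five letters of the decay currency in one statement, cubic tori -/

/-- **THE VECTOR LETTERS IN `RowDecay` FORM ON CUBIC UNIT TORI, ONE PAIR `(C, δ)`, UNCONDITIONAL**: `∃ C δ > 0` (functions of `d`) such that for
every `n ≥ 1`, every `N₀ ≥ 1`, all directions `μ, ν`, with `T := fun _ ⇒ N₀`, `𝒢 := (DeltaA n T 1)⁻¹`, `∇ := fdiff (fine n T) n` and the block maps
`blockOf ∘ Prod.fst`:  `RowDecay T … 𝒢 C δ ∧ RowDecay T … (𝒢∇ᴴ_ν) C δ ∧ RowDecay T … (∇_ν𝒢) C δ ∧ RowDecay T … (𝒢∇ᴴ_μ∇ᴴ_ν) (C(1 + log n)) δ ∧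
RowDecay T … (∇_μ∇_ν𝒢) (C(1 + log n)) δ`. [folklore] -/
theorem vectorRowDecay_one_cubic :
    ∃ C δ : ℝ, 0 < C ∧ 0 < δ ∧ ∀ (n N₀ : ℕ) [NeZero n] [NeZero N₀] (μ ν : Fin (d + 1)),
      RowDecay (fun _ : Fin (d + 1) => N₀)
          (fun i : Tor (fine n (fun _ : Fin (d + 1) => N₀)) × Fin (d + 1) => blockOf n (fun _ : Fin (d + 1) => N₀) i.1)
          (fun x' : Tor (fine n (fun _ : Fin (d + 1) => N₀)) × Fin (d + 1) => blockOf n (fun _ : Fin (d + 1) => N₀) x'.1)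
          (DeltaA n (fun _ : Fin (d + 1) => N₀) 1)⁻¹ C δ ∧
      RowDecay (fun _ : Fin (d + 1) => N₀)
          (fun i : Tor (fine n (fun _ : Fin (d + 1) => N₀)) × Fin (d + 1) => blockOf n (fun _ : Fin (d + 1) => N₀) i.1)
          (fun x' : Tor (fine n (fun _ : Fin (d + 1) => N₀)) × Fin (d + 1) => blockOf n (fun _ : Fin (d + 1) => N₀) x'.1)
          ((DeltaA n (fun _ : Fin (d + 1) => N₀) 1)⁻¹ * (fdiff (fine n (fun _ : Fin (d + 1) => N₀)) (n : ℂ) ν)ᴴ) C δ ∧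
      RowDecay (fun _ : Fin (d + 1) => N₀)
          (fun i : Tor (fine n (fun _ : Fin (d + 1) => N₀)) × Fin (d + 1) => blockOf n (fun _ : Fin (d + 1) => N₀) i.1)
          (fun x' : Tor (fine n (fun _ : Fin (d + 1) => N₀)) × Fin (d + 1) => blockOf n (fun _ : Fin (d + 1) => N₀) x'.1)
          (fdiff (fine n (fun _ : Fin (d + 1) => N₀)) (n : ℂ) ν * (DeltaA n (fun _ : Fin (d + 1) => N₀) 1)⁻¹) C δ ∧
      RowDecay (fun _ : Fin (d + 1) => N₀)
          (fun i : Tor (fine n (fun _ : Fin (d + 1) => N₀)) × Fin (d + 1) => blockOf n (fun _ : Fin (d + 1) => N₀) i.1)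
          (fun x' : Tor (fine n (fun _ : Fin (d + 1) => N₀)) × Fin (d + 1) => blockOf n (fun _ : Fin (d + 1) => N₀) x'.1)
          ((DeltaA n (fun _ : Fin (d + 1) => N₀) 1)⁻¹ * (fdiff (fine n (fun _ : Fin (d + 1) => N₀)) (n : ℂ) μ)ᴴ
            * (fdiff (fine n (fun _ : Fin (d + 1) => N₀)) (n : ℂ) ν)ᴴ) (C * (1 + Real.log n)) δ ∧
      RowDecay (fun _ : Fin (d + 1) => N₀)
          (fun i : Tor (fine n (fun _ : Fin (d + 1) => N₀)) × Fin (d + 1) => blockOf n (fun _ : Fin (d + 1) => N₀) i.1)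
          (fun x' : Tor (fine n (fun _ : Fin (d + 1) => N₀)) × Fin (d + 1) => blockOf n (fun _ : Fin (d + 1) => N₀) x'.1)
          (fdiff (fine n (fun _ : Fin (d + 1) => N₀)) (n : ℂ) μ * fdiff (fine n (fun _ : Fin (d + 1) => N₀)) (n : ℂ) ν
            * (DeltaA n (fun _ : Fin (d + 1) => N₀) 1)⁻¹) (C * (1 + Real.log n)) δ := by
  obtain ⟨C₀, δ₀, hC₀, hδ₀, h₀⟩ := rowDecay_inv_one d
  obtain ⟨C₁, δ₁, hC₁, hδ₁, h₁⟩ := rowDecay_inv_fdiffH_one d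
  obtain ⟨C₂, δ₂, hC₂, hδ₂, h₂⟩ := rowDecay_fdiff_inv_one d
  obtain ⟨C₃, δ₃, hC₃, hδ₃, h₃⟩ := rowDecay_inv_fdiffH_fdiffH_one_cubic d
  obtain ⟨C₄, δ₄, hC₄, hδ₄, h₄⟩ := rowDecay_fdiff_fdiff_inv_one_cubic d
  set C := max C₀ (max C₁ (max C₂ (max C₃ C₄))) with hC
  set δ := min δ₀ (min δ₁ (min δ₂ (min δ₃ δ₄))) with hδ
  have hCpos : 0 < C := lt_max_of_lt_left hC₀
  have hC0' : C₀ ≤ C := le_max_left _ _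
  have hC1' : C₁ ≤ C := (le_max_left _ _).trans (le_max_right _ _)
  have hC2' : C₂ ≤ C := ((le_max_left _ _).trans (le_max_right _ _)).trans (le_max_right _ _)
  have hC3' : C₃ ≤ C := (((le_max_left _ _).trans (le_max_right _ _)).trans (le_max_right _ _)).trans (le_max_right _ _)
  have hC4' : C₄ ≤ C := (((le_max_right _ _).trans (le_max_right _ _)).trans (le_max_right _ _)).trans (le_max_right _ _)
  have hδ0' : δ ≤ δ₀ := min_le_left _ _
  have hδ1' : δ ≤ δ₁ := (min_le_right _ _).trans (min_le_left _ _)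
  have hδ2' : δ ≤ δ₂ := ((min_le_right _ _).trans (min_le_right _ _)).trans (min_le_left _ _)
  have hδ3' : δ ≤ δ₃ := (((min_le_right _ _).trans (min_le_right _ _)).trans (min_le_right _ _)).trans (min_le_left _ _)
  have hδ4' : δ ≤ δ₄ := (((min_le_right _ _).trans (min_le_right _ _)).trans (min_le_right _ _)).trans (min_le_right _ _)
  refine ⟨C, δ, hCpos, lt_min hδ₀ (lt_min hδ₁ (lt_min hδ₂ (lt_min hδ₃ hδ₄))), fun n N₀ _ _ μ ν => ?_⟩
  have hn : (1 : ℝ) ≤ n := by exact_mod_cast Nat.one_le_iff_ne_zero.mpr (NeZero.ne n)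
  have hlog : 0 ≤ Real.log (n : ℝ) := Real.log_nonneg hn
  have hClog : 0 ≤ C * (1 + Real.log n) := by positivity
  refine ⟨(h₀ n _).mono hC0' hCpos.le hδ0', (h₁ n _ ν).mono hC1' hCpos.le hδ1', (h₂ n _ ν).mono hC2' hCpos.le hδ2',
    (h₃ n N₀ μ ν).mono (mul_le_mul_of_nonneg_right hC3' (by linarith)) hClog hδ3',
    (h₄ n N₀ μ ν).mono (mul_le_mul_of_nonneg_right hC4' (by linarith)) hClog hδ4'⟩

end Summit.QuantumFields.BalabanUV.Beta.GAN24.VectorRowDecayLetters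

end
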